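import Summits.CriticalPhenomena.PercolationContinuityZ3.Theorems.PercAnnulusCrossingIICVolumeUpper
import Literature.Probability.Percolation.UniformPercolation
import HarnessLib

/-!
# The one-arm sum over a ball and the half-count around a far site (lane RSW3, p1 gen 21)

builds on p205010 (kernel theorem, internal audit signed; external expert review pending) — NOT used in this file.

RSW3 lane (LANE 3 `prim-rsw3`), seat `prim-rsw3-p1` (gen 21).  Helper file (`--supports stmt-CriticalPhenomena-4575`);
no definitions, no sorries.  Memo `run/shared/lean/prim/rsw3/P1-QM.md` §34.  Deterministic / `P_{p_c}`-level bookkeeping for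
`…IICVolumeHomogeneity` (the mean volume of Kesten's IIC around a far IIC site):

* `sum_box_oneArmProb_supNorm_le_criticalProbI` — THE ONE-ARM SUM OVER A BALL: **`Σ_{w ∈ Λ(n)} π_{p_c}(‖w‖) ≤ C·n^d·π_{p_c}(n)`** (`n ≥ 1`;
  `d ≥ 2`, one-arm quasi-multiplicativity `OneArmQuasiMultAt d p_c c`: `π(k) ≤ (2d/c)(4n/k)^{d−1}π(n)` by the annulus window,
  `|∂Λ(k)| ≤ 2d(3k)^{d−1}`, BK floor for `w = 0`) — the same computation as gen 7's `E_ν|C(0) ∩ Λ(n)| ≤ Cn^dπ(n)`, with `π(‖w‖)` in place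
  of `ν(0 ↔ w)`;
* `supNorm_le_supNorm_add_or_sub` — **`‖x‖ ≤ ‖x + w‖` or `‖x‖ ≤ ‖x − w‖`** (look at a maximal coordinate of `x`);
* `card_box_le_two_mul_card_filter`, `pow_le_two_mul_card_filter` — hence **at least half of the sites `w` with `m ≤ ‖w‖ ≤ r` satisfy
  `‖x + w‖ ≥ ‖x‖`**, and there are `≥ r^d/2` of them when `2m ≤ r`.
References: H. Kesten, Probab. Theory Relat. Fields 73 (1986) Thm. (8).
-/

noncomputable section

namespace Summit.CriticalPhenomena.PercolationContinuityZ3.Theorems.Crossing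

open MeasureTheory Filter Topology Literature.Probability.Percolation Literature.Probability.LatticeModels
open Literature.Probability.Percolation.DCT16
open Summit.CriticalPhenomena.PercolationContinuityZ3.Theorems.SurfaceTension

variable {d : ℕ}

/-! ## §1 The one-arm sum over a ball -/

open Classical in
/-- **`Σ_{w ∈ Λ(n)} π_{p_c}(‖w‖_∞) ≤ C·n^d·π_{p_c}(n)`** for `n ≥ 1` (`d ≥ 2`, `OneArmQuasiMultAt d p_c c`, `c > 0`): fibrewise over
`k = ‖w‖ ∈ [1, n]` with `π(k) ≤ (2d/c)(4n/k)^{d−1}π(n)` (quasi-multiplicativity and the annulus window) and `|∂Λ(k)| ≤ 2d(3k)^{d−1}`;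
the origin contributes `1 ≤ n^dπ(n)/c₁` by the BK floor `π_{p_c}(n) ≥ c₁ n^{−(d−1)/2}`. [cite: Kesten1986, Thm. (8)] -/
theorem sum_box_oneArmProb_supNorm_le_criticalProbI (hd : 2 ≤ d) {c : ℝ} (hc : 0 < c)
    (hQM : OneArmQuasiMultAt d (criticalProbI d) c) :
    ∃ C : ℝ, 0 < C ∧ ∀ n : ℕ, 1 ≤ n →
      ∑ w ∈ box d n, oneArmProb d (criticalProbI d) (Site.supNorm w) ≤ C * (n : ℝ) ^ d * oneArmProb d (criticalProbI d) n := by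
  obtain ⟨c₁, hc₁, hfloor⟩ := exists_oneArmProb_criticalProbI_lower_half (d := d) hd
  have hd0 : (0 : ℝ) < d := by exact_mod_cast (lt_of_lt_of_le (by norm_num : 0 < 2) hd)
  have hd1 : 1 ≤ d := le_trans (by norm_num) hd
  refine ⟨1 / c₁ + 2 * d * (2 * d / c) * (12 : ℝ) ^ (d - 1), by positivity, fun n hn => ?_⟩
  have hn0 : (0 : ℝ) < n := by exact_mod_cast hn
  have hπn : 0 ≤ oneArmProb d (criticalProbI d) n := measureReal_nonneg
  set P : Site d → Prop := fun z => 1 ≤ Site.supNorm z with hP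
  rw [← Finset.sum_filter_add_sum_filter_not (box d n) P]
  -- (i) the sites with `1 ≤ ‖w‖ ≤ n`, fibrewise
  have hfar : ∑ z ∈ (box d n).filter P, oneArmProb d (criticalProbI d) (Site.supNorm z) ≤
      2 * d * (2 * d / c) * (12 : ℝ) ^ (d - 1) * (n : ℝ) ^ d * oneArmProb d (criticalProbI d) n := by
    have hmaps : ∀ z ∈ (box d n).filter P, Site.supNorm z ∈ Finset.Icc 1 n := by
      intro z hz
      rw [Finset.mem_filter] at hz
      exact Finset.mem_Icc.2 ⟨hz.2, mem_box_iff_supNorm_le.1 hz.1⟩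
    rw [← Finset.sum_fiberwise_of_maps_to hmaps]
    have hinner : ∀ k ∈ Finset.Icc 1 n, ∑ z ∈ ((box d n).filter P).filter (fun z => Site.supNorm z = k),
        oneArmProb d (criticalProbI d) (Site.supNorm z) ≤
        2 * d * (2 * d / c) * (12 : ℝ) ^ (d - 1) * (n : ℝ) ^ (d - 1) * oneArmProb d (criticalProbI d) n := by
      intro k hk
      rw [Finset.mem_Icc] at hk
      have hk0 : (0 : ℝ) < k := by exact_mod_cast hk.1
      have hsub : ((box d n).filter P).filter (fun z => Site.supNorm z = k) ⊆ sphere d k := by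
        intro z hz
        simp only [Finset.mem_filter] at hz
        exact (mem_sphere).2 hz.2
      -- the per-site bound `π(k) ≤ (2d/c)(4n/k)^{d-1} π(n)`
      have hratio := oneArmProb_mul_pow_le_of_oneArmQuasiMultAt hd hc hQM hk.1 hk.2
      have hqpos : 0 < ((k : ℝ) / (4 * n)) ^ (d - 1) := by positivity
      have hsite : oneArmProb d (criticalProbI d) k ≤ 2 * d / c * ((4 * (n : ℝ)) / k) ^ (d - 1) * oneArmProb d (criticalProbI d) n := by
        rw [← le_div_iff₀ hqpos] at hratio
        refine hratio.trans (le_of_eq ?_)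
        rw [div_eq_mul_inv, ← inv_pow, inv_div]
        ring
      have hterm : ∀ z ∈ ((box d n).filter P).filter (fun z => Site.supNorm z = k),
          oneArmProb d (criticalProbI d) (Site.supNorm z) ≤ 2 * d / c * ((4 * (n : ℝ)) / k) ^ (d - 1) * oneArmProb d (criticalProbI d) n := by
        intro z hz
        simp only [Finset.mem_filter] at hz
        rw [hz.2]
        exact hsite
      calc ∑ z ∈ ((box d n).filter P).filter (fun z => Site.supNorm z = k), oneArmProb d (criticalProbI d) (Site.supNorm z)
          ≤ ∑ _z ∈ ((box d n).filter P).filter (fun z => Site.supNorm z = k),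
              2 * d / c * ((4 * (n : ℝ)) / k) ^ (d - 1) * oneArmProb d (criticalProbI d) n := Finset.sum_le_sum hterm
        _ = ((((box d n).filter P).filter (fun z => Site.supNorm z = k)).card : ℝ) *
              (2 * d / c * ((4 * (n : ℝ)) / k) ^ (d - 1) * oneArmProb d (criticalProbI d) n) := by
            rw [Finset.sum_const, nsmul_eq_mul]
        _ ≤ 2 * d * (3 * (k : ℝ)) ^ (d - 1) * (2 * d / c * ((4 * (n : ℝ)) / k) ^ (d - 1) * oneArmProb d (criticalProbI d) n) := by
            refine mul_le_mul_of_nonneg_right ?_ (by positivity)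
            exact le_trans (by exact_mod_cast Finset.card_le_card hsub) (card_sphere_le_pow hd1 hk.1)
        _ = 2 * d * (2 * d / c) * ((3 * (k : ℝ)) ^ (d - 1) * ((4 * (n : ℝ)) / k) ^ (d - 1)) * oneArmProb d (criticalProbI d) n := by
            ring
        _ = 2 * d * (2 * d / c) * (12 : ℝ) ^ (d - 1) * (n : ℝ) ^ (d - 1) * oneArmProb d (criticalProbI d) n := by
            have hkey : (3 * (k : ℝ)) ^ (d - 1) * ((4 * (n : ℝ)) / k) ^ (d - 1) = (12 : ℝ) ^ (d - 1) * (n : ℝ) ^ (d - 1) := by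
              rw [← mul_pow, ← mul_pow]
              congr 1
              field_simp
              ring
            rw [hkey]; ring
    calc ∑ k ∈ Finset.Icc 1 n, ∑ z ∈ ((box d n).filter P).filter (fun z => Site.supNorm z = k),
          oneArmProb d (criticalProbI d) (Site.supNorm z)
        ≤ ∑ _k ∈ Finset.Icc 1 n, 2 * d * (2 * d / c) * (12 : ℝ) ^ (d - 1) * (n : ℝ) ^ (d - 1) * oneArmProb d (criticalProbI d) n :=
          Finset.sum_le_sum hinner
      _ = ((Finset.Icc 1 n).card : ℝ) * (2 * d * (2 * d / c) * (12 : ℝ) ^ (d - 1) * (n : ℝ) ^ (d - 1) *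
          oneArmProb d (criticalProbI d) n) := by rw [Finset.sum_const, nsmul_eq_mul]
      _ = (n : ℝ) * (2 * d * (2 * d / c) * (12 : ℝ) ^ (d - 1) * (n : ℝ) ^ (d - 1) * oneArmProb d (criticalProbI d) n) := by
          rw [Nat.card_Icc]; norm_num
      _ = 2 * d * (2 * d / c) * (12 : ℝ) ^ (d - 1) * ((n : ℝ) * (n : ℝ) ^ (d - 1)) * oneArmProb d (criticalProbI d) n := by ring
      _ = 2 * d * (2 * d / c) * (12 : ℝ) ^ (d - 1) * (n : ℝ) ^ d * oneArmProb d (criticalProbI d) n := by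
          rw [← pow_succ', Nat.sub_add_cancel hd1]
  -- (ii) the origin: `π(0) ≤ 1 ≤ n^d π(n)/c₁`
  have hnear : ∑ z ∈ (box d n).filter (fun z => ¬ P z), oneArmProb d (criticalProbI d) (Site.supNorm z) ≤
      1 / c₁ * (n : ℝ) ^ d * oneArmProb d (criticalProbI d) n := by
    have hsub : (box d n).filter (fun z => ¬ P z) ⊆ {0} := by
      intro z hz
      rw [Finset.mem_filter] at hz
      simp only [hP, not_le, Nat.lt_one_iff] at hz
      rw [Finset.mem_singleton]
      exact Site.supNorm_eq_zero_iff.mp hz.2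
    have hcard : (((box d n).filter (fun z => ¬ P z)).card : ℝ) ≤ 1 := by
      have h := Finset.card_le_card hsub
      rw [Finset.card_singleton] at h
      exact_mod_cast h
    have hone : (1 : ℝ) ≤ 1 / c₁ * (n : ℝ) ^ d * oneArmProb d (criticalProbI d) n := by
      have hπ := hfloor n hn
      have hpos : 0 < (n : ℝ) ^ (((d : ℝ) - 1) / 2) := Real.rpow_pos_of_pos hn0 _
      rw [div_le_iff₀ hpos] at hπ
      have hexp : (n : ℝ) ^ (((d : ℝ) - 1) / 2) ≤ (n : ℝ) ^ d := by
        have h1 : (1 : ℝ) ≤ n := by exact_mod_cast hn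
        calc (n : ℝ) ^ (((d : ℝ) - 1) / 2) ≤ (n : ℝ) ^ (d : ℝ) :=
              Real.rpow_le_rpow_of_exponent_le h1 (by linarith [hd0])
          _ = (n : ℝ) ^ d := Real.rpow_natCast _ _
      have hc₁le : c₁ ≤ (n : ℝ) ^ d * oneArmProb d (criticalProbI d) n :=
        hπ.trans (by rw [mul_comm]; exact mul_le_mul_of_nonneg_right hexp hπn)
      rw [show 1 / c₁ * (n : ℝ) ^ d * oneArmProb d (criticalProbI d) n = ((n : ℝ) ^ d * oneArmProb d (criticalProbI d) n) / c₁ by ring]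
      rw [le_div_iff₀ hc₁, one_mul]
      exact hc₁le
    calc ∑ z ∈ (box d n).filter (fun z => ¬ P z), oneArmProb d (criticalProbI d) (Site.supNorm z)
        ≤ ∑ _z ∈ (box d n).filter (fun z => ¬ P z), (1 : ℝ) := Finset.sum_le_sum fun z _ => measureReal_le_one
      _ = (((box d n).filter (fun z => ¬ P z)).card : ℝ) := by rw [Finset.sum_const, nsmul_eq_mul, mul_one]
      _ ≤ 1 := hcard
      _ ≤ _ := hone
  calc ∑ z ∈ (box d n).filter P, oneArmProb d (criticalProbI d) (Site.supNorm z) +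
        ∑ z ∈ (box d n).filter (fun z => ¬ P z), oneArmProb d (criticalProbI d) (Site.supNorm z)
      ≤ 2 * d * (2 * d / c) * (12 : ℝ) ^ (d - 1) * (n : ℝ) ^ d * oneArmProb d (criticalProbI d) n +
          1 / c₁ * (n : ℝ) ^ d * oneArmProb d (criticalProbI d) n := add_le_add hfar hnear
    _ = (1 / c₁ + 2 * d * (2 * d / c) * (12 : ℝ) ^ (d - 1)) * (n : ℝ) ^ d * oneArmProb d (criticalProbI d) n := by ring

/-! ## §2 Half of the sites around `x` are at least as far from the root as `x` -/

/-- **`‖x‖ ≤ ‖x + w‖` or `‖x‖ ≤ ‖x − w‖`** (sup norm on `ℤ^d`): at a coordinate `i` where `|x_i| = ‖x‖`,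
`max(|x_i + w_i|, |x_i − w_i|) ≥ |x_i|`. [folklore] -/
theorem supNorm_le_supNorm_add_or_sub (x w : Site d) :
    Site.supNorm x ≤ Site.supNorm (x + w) ∨ Site.supNorm x ≤ Site.supNorm (x - w) := by
  rcases Nat.eq_zero_or_pos d with hd | hd
  · subst hd
    left
    have : Site.supNorm x = 0 := Site.supNorm_eq_zero_iff.mpr (Subsingleton.elim _ _)
    omega
  · obtain ⟨i, hi⟩ := Site.exists_natAbs_eq_supNorm (Finset.univ_nonempty_iff.2 ⟨⟨0, hd⟩⟩) x
    have h1 := Site.natAbs_le_supNorm (x + w) i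
    have h2 := Site.natAbs_le_supNorm (x - w) i
    simp only [Pi.add_apply, Pi.sub_apply] at h1 h2
    rw [← hi]
    omega

open Classical in
/-- **At least half of the sites `w` with `m ≤ ‖w‖ ≤ r` satisfy `‖x + w‖ ≥ ‖x‖`**: `|Λ(r) ∖ Λ(m−1)| ≤ 2·#{w ∈ Λ(r) : m ≤ ‖w‖, ‖x‖ ≤ ‖x + w‖}`
(the complement is mapped into the set by `w ↦ −w`, `supNorm_le_supNorm_add_or_sub`). [folklore] -/
theorem card_box_le_two_mul_card_filter (x : Site d) (m r : ℕ) :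
    ((box d r).filter fun w => m ≤ Site.supNorm w).card ≤
      2 * ((box d r).filter fun w => m ≤ Site.supNorm w ∧ Site.supNorm x ≤ Site.supNorm (x + w)).card := by
  set G := (box d r).filter fun w => m ≤ Site.supNorm w ∧ Site.supNorm x ≤ Site.supNorm (x + w) with hG
  have hcover : ((box d r).filter fun w => m ≤ Site.supNorm w) ⊆ G ∪ G.image (fun w => -w) := by
    intro w hw
    rw [Finset.mem_filter] at hw
    rw [Finset.mem_union]
    rcases supNorm_le_supNorm_add_or_sub x w with h | h
    · exact Or.inl (Finset.mem_filter.2 ⟨hw.1, hw.2, h⟩)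
    · refine Or.inr (Finset.mem_image.2 ⟨-w, Finset.mem_filter.2 ⟨neg_mem_box_iff.2 hw.1, ?_, ?_⟩, neg_neg w⟩)
      · rw [Site.supNorm_neg]; exact hw.2
      · rw [← sub_eq_add_neg]; exact h
  calc ((box d r).filter fun w => m ≤ Site.supNorm w).card ≤ (G ∪ G.image (fun w => -w)).card := Finset.card_le_card hcover
    _ ≤ G.card + (G.image (fun w => -w)).card := Finset.card_union_le _ _
    _ ≤ G.card + G.card := Nat.add_le_add_left Finset.card_image_le _
    _ = 2 * G.card := by ring

open Classical in
/-- The count: for `1 ≤ m` and `2m ≤ r`, `#{w ∈ Λ(r) : m ≤ ‖w‖} = (2r+1)^d − (2m−1)^d ≥ (2r+1)^d / 2 ≥ r^d`, hence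
**`r^d ≤ 2·#{w ∈ Λ(r) : m ≤ ‖w‖, ‖x‖ ≤ ‖x + w‖}`** (`d ≥ 1`). [folklore] -/
theorem pow_le_two_mul_card_filter (hd : 1 ≤ d) (x : Site d) {m r : ℕ} (hm : 1 ≤ m) (hmr : 2 * m ≤ r) :
    (r : ℝ) ^ d ≤ 2 * (((box d r).filter fun w => m ≤ Site.supNorm w ∧ Site.supNorm x ≤ Site.supNorm (x + w)).card : ℝ) := by
  have hcount : (box d r).filter (fun w => m ≤ Site.supNorm w) = box d r \ box d (m - 1) := by
    ext w
    simp only [Finset.mem_filter, Finset.mem_sdiff, mem_box_iff_supNorm_le]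
    constructor
    · rintro ⟨h1, h2⟩; exact ⟨h1, by omega⟩
    · rintro ⟨h1, h2⟩; exact ⟨h1, by omega⟩
  have hsub : box d (m - 1) ⊆ box d r := box_mono d (by omega)
  have hcard : ((box d r).filter (fun w => m ≤ Site.supNorm w)).card = (2 * r + 1) ^ d - (2 * (m - 1) + 1) ^ d := by
    rw [hcount, Finset.card_sdiff_of_subset hsub, card_box, card_box]
  have h2 := card_box_le_two_mul_card_filter x m r
  rw [hcard] at h2
  -- `2·(2m−1)^d ≤ (4m−2)^d ≤ (2r+1)^d`, so `(2r+1)^d − (2m−1)^d ≥ (2r+1)^d/2 ≥ r^d`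
  have hA : 2 * (2 * (m - 1) + 1) ^ d ≤ (2 * r + 1) ^ d := by
    have h3 : (2 * (2 * (m - 1) + 1)) ^ d ≤ (2 * r + 1) ^ d := Nat.pow_le_pow_left (by omega) d
    have h4 : 2 * (2 * (m - 1) + 1) ^ d ≤ (2 * (2 * (m - 1) + 1)) ^ d := by
      rw [mul_pow]
      exact Nat.mul_le_mul_right _ (by
        calc 2 = 2 ^ 1 := by norm_num
          _ ≤ 2 ^ d := Nat.pow_le_pow_right (by norm_num) hd)
    exact h4.trans h3
  have hB : r ^ d ≤ (2 * r + 1) ^ d - (2 * (m - 1) + 1) ^ d := by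
    have h5 : 2 * r ^ d ≤ (2 * r + 1) ^ d := by
      calc 2 * r ^ d ≤ 2 ^ d * r ^ d := Nat.mul_le_mul_right _ (by
            calc 2 = 2 ^ 1 := by norm_num
              _ ≤ 2 ^ d := Nat.pow_le_pow_right (by norm_num) hd)
        _ = (2 * r) ^ d := by rw [mul_pow]
        _ ≤ (2 * r + 1) ^ d := Nat.pow_le_pow_left (by omega) d
    omega
  have h6 : r ^ d ≤ 2 * ((box d r).filter fun w => m ≤ Site.supNorm w ∧ Site.supNorm x ≤ Site.supNorm (x + w)).card :=
    hB.trans h2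
  exact_mod_cast h6

/-- **The one-arm ball sum under (A2)□** (`p_c(ℤ^d)`, `d ≥ 2`; (A2)□ at aspect `(s,L)`, `2 ≤ s ≤ L`, `ϰ > 0`): there is `C` with
**`Σ_{w ∈ Λ(n)} π_{p_c}(‖w‖) ≤ C·n^d·π_{p_c}(n)`** for all `n ≥ 1` (one-arm quasi-multiplicativity follows from (A2)□). [cite: Kesten1986, Thm. (8)] -/
theorem exists_sum_box_oneArmProb_supNorm_le_criticalProbI (hd : 2 ≤ d) {s L : ℕ} (hs : 2 ≤ s) (hsL : s ≤ L) {ϰ : ℝ}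
    (hϰ : 0 < ϰ) (hA2 : SetToSetQuasiMultAspectAt d (criticalProbI d) s L ϰ) :
    ∃ C : ℝ, 0 < C ∧ ∀ n : ℕ, 1 ≤ n →
      ∑ w ∈ box d n, oneArmProb d (criticalProbI d) (Site.supNorm w) ≤ C * (n : ℝ) ^ d * oneArmProb d (criticalProbI d) n := by
  obtain ⟨c, hc, hQM⟩ := oneArmQuasiMultAt_of_setToSetQuasiMultAspectAt hd hs hsL hϰ hA2
  exact sum_box_oneArmProb_supNorm_le_criticalProbI hd hc hQM

end Summit.CriticalPhenomena.PercolationContinuityZ3.Theorems.Crossing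

end
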